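import Literature.MathematicalPhysics.QuantumChemistry.SecondQuantizedHamiltonian
import HarnessLib

/-!
# The Slater–Condon rules, I: strings of elementary operators and identical ON vectors

Topic `MathematicalPhysics/QuantumChemistry`. Matrix elements of second-quantization one- and
two-electron operators between occupation-number (ON) vectors — the **Slater–Condon rules** as
derived in Helgaker–Jørgensen–Olsen, *Molecular Electronic-Structure Theory* (2000) §1.4.1–1.4.2 —
on the tree's Jordan–Wigner Fock space `Fock ι = Finset ι → ℂ` (`HubbardWave0`, `FermionOperators`:
`annihilation`, `creation`, `jwSign`; ON vector `|k⟩ = Pi.single k 1`, `k : Finset ι` the set of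
occupied spin orbitals; the Jordan–Wigner sign `jwSign P k = (-1)^#{Q ∈ k | Q < P}` IS HJO's phase
factor `Γ_P^k = Π_{Q<P} (-1)^{k_Q}` of eq. (1.2.3), and the tree's `annihilation_mulVec_single`,
`creation_mulVec_single` are HJO's (1.2.16), (1.2.5)).

The one-electron operator `f̂ = Σ_{PQ} f_{PQ} a†_P a_Q` (HJO (1.4.2)) is the tree's `dGamma f`
(`FermionQuasiFree`); the two-electron operator `ĝ = ½ Σ_{PQRS} g_{PQRS} a†_P a†_R a_S a_Q`
(HJO (1.4.15)) is `twoElectronOp g` below. This file (part I of four) proves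

* the diagonal elements of the strings `a†_P a_Q` (occupation numbers, HJO (1.3.2), (1.4.9)) and
  `a†_P a†_R a_S a_Q` (HJO (1.4.27)–(1.4.31)), and `a_P |k⟩ = 0` for `P` empty (1.2.16);
* **Case 1, identical ON vectors**: `⟨k|f̂|k⟩ = Σ_P k_P f_PP` (1.4.3) and
  `⟨k|ĝ|k⟩ = ½ Σ_{PR} k_P k_R (g_PPRR − g_PRRP)` (1.4.18).

Parts II–IV: `SlaterCondonRulesStrings` (the transition strings `a†_I a_J`, `a†_I a†_J a_L a_K`, their
contracted diagonal elements (1.4.11), (1.4.34), and the vanishing rules (1.4.7), (1.4.25)),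
`SlaterCondonRulesTransitions` ((1.4.6), (1.4.21), (1.4.24)), `SlaterCondonRulesMolecular` (the rules
for the tree's orbital-basis Hamiltonian `molecularHamiltonian h g h_nuc`, HJO (2.2.18) = (1.4.39)
with the spin-orbital integrals (2.2.3), (2.2.10)). Everything is PROVED (0 sorry); the only new
definitions are `twoElectronOp` (here) and the printed integral tables `spinFreeOne`, `spinFreeTwo`
(part IV).

Related tree results (not duplicated): the non-orthogonal ("Löwdin") generalisation for determinant
pairs built from orbital matrices is `QuantumLattice/NonorthogonalSlaterKernels.lean`; the diagonal
element of `molecularHamiltonian` on `|α↑β↓⟩` in closed form (`Model.detEnergy`) is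
`Summits/Ventures/CertifiedQuantumChemistry/Rows/DeterminantEnergy.lean` (Summits side).

## References

* T. Helgaker, P. Jørgensen, J. Olsen, *Molecular Electronic-Structure Theory*, Wiley (2000), §1.2
  eqs. (1.2.3), (1.2.5), (1.2.16), (1.2.22), (1.2.29); §1.3.1 eq. (1.3.2); §1.4.1 eqs. (1.4.2)–(1.4.13);
  §1.4.2 eqs. (1.4.14)–(1.4.38); §1.4.3 eq. (1.4.39); held copy
  `book:helgakernd-molecular-electronic-structure-theory` (chunks p0039–p0042, p0045–p0049 read
  2026-08-21). [cite: HelgakerJorgensenOlsen2000, §1.4.1–1.4.2]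
* J. C. Slater, Phys. Rev. 34 (1929) 1293; E. U. Condon, Phys. Rev. 36 (1930) 1121 (the original
  rules; ref. [1] of HJO Ch. 1).
-/

noncomputable section

namespace Literature.MathematicalPhysics.QuantumChemistry

open Matrix Finset
open Literature.MathematicalPhysics.QuantumLattice

section SpinOrbital

variable {ι : Type*} [LinearOrder ι] [Fintype ι]

/-- The **second-quantization two-electron operator** `ĝ = ½ Σ_{PQRS} g_{PQRS} a†_P a†_R a_S a_Q`
of a spin-orbital basis `ι` (annihilators to the right of the creators, conventional factor `½`).
Helgaker–Jørgensen–Olsen (2000) eq. (1.4.15). [cite: HelgakerJorgensenOlsen2000, eq. (1.4.15)] -/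
def twoElectronOp (g : ι → ι → ι → ι → ℂ) : Matrix (Finset ι) (Finset ι) ℂ :=
  (1 / 2 : ℂ) • ∑ P, ∑ Q, ∑ R, ∑ S,
    g P Q R S • (creation P * creation R * annihilation S * annihilation Q)

/-! ### Diagonal elements of the elementary strings (occupation numbers) -/

/-- `X_{IJ} = (X |J⟩)_I` for the ON vector `|J⟩ = e_J` (plumbing). [folklore] -/
private theorem apply_eq_mulVec_single (X : Matrix (Finset ι) (Finset ι) ℂ) (I J : Finset ι) :
    X I J = (X *ᵥ Pi.single J (1 : ℂ)) I := by
  rw [mulVec_single_one, col_apply]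

/-- `a_P |k⟩ = 0` if the spin orbital `P` is unoccupied in `|k⟩` — Helgaker–Jørgensen–Olsen (2000)
eq. (1.2.16) (the factor `δ_{k_P 1}`). [cite: HelgakerJorgensenOlsen2000, eq. (1.2.16)] -/
theorem annihilation_mulVec_single_of_not_mem {u : ι} {T : Finset ι} (hu : u ∉ T) :
    annihilation u *ᵥ Pi.single T (1 : ℂ) = 0 := by
  rw [annihilation_mulVec_single, if_neg hu]

/-- `⟨k| a†_P a_Q |k⟩ = δ_{PQ} k_Q`: the occupation-number operator `N̂_P = a†_P a_P` has
`N̂_P |k⟩ = k_P |k⟩` (Helgaker–Jørgensen–Olsen (2000) eq. (1.3.2)), and for `P ≠ Q` the string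
`a†_P a_Q` has no diagonal element (eq. (1.4.9): "which occurs for `P = Q` only").
[cite: HelgakerJorgensenOlsen2000, eqs. (1.3.2), (1.4.9)] -/
theorem creation_mul_annihilation_apply_self (x y : ι) (D : Finset ι) :
    (creation x * annihilation y) D D = if x = y ∧ y ∈ D then 1 else 0 := by
  rw [apply_eq_mulVec_single (creation x * annihilation y) D D, ← mulVec_mulVec,
    annihilation_mulVec_single]
  by_cases hy : y ∈ D
  · rw [if_pos hy, mulVec_smul, FermionOperatorsProofs.creation_mulVec_single]
    by_cases hxy : x = y
    · subst hxy
      rw [if_neg (notMem_erase x D), smul_smul, insert_erase hy, Pi.smul_apply, Pi.single_eq_same,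
        smul_eq_mul, mul_one, jwSign_erase_of_not_lt (lt_irrefl x), jwSign_mul_self,
        if_pos ⟨rfl, hy⟩]
    · rw [if_neg (show ¬(x = y ∧ y ∈ D) from fun h => hxy h.1)]
      by_cases hx : x ∈ D.erase y
      · rw [if_pos hx, smul_zero, Pi.zero_apply]
      · rw [if_neg hx, smul_smul, Pi.smul_apply, Pi.single_eq_of_ne, smul_zero]
        intro hD
        have hy' : y ∈ insert x (D.erase y) := hD ▸ hy
        rcases mem_insert.1 hy' with h | h
        · exact hxy h.symm
        · exact notMem_erase y D h
  · rw [if_neg hy, mulVec_zero, Pi.zero_apply, if_neg (show ¬(x = y ∧ y ∈ D) from fun h => hy h.2)]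

/-- **Diagonal element of the two-electron string** — Helgaker–Jørgensen–Olsen (2000) eqs.
(1.4.27)–(1.4.31): `⟨k| a†_w a†_x a_y a_z |k⟩` is nonzero only in the two cases `w = z, x = y` and
`w = y, x = z` of (1.4.28) (and vanishes when both hold), with the value `k_y k_z` resp. `−k_y k_z`
given by `a†_P a†_R a_R a_P = −δ_{PR} N̂_P + N̂_P N̂_R` (1.4.30); in one formula,
`⟨k| a†_w a†_x a_y a_z |k⟩ = k_y k_z (δ_{wz} δ_{xy} − δ_{wy} δ_{xz})`.
[cite: HelgakerJorgensenOlsen2000, eqs. (1.4.28)–(1.4.31)] -/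
theorem twoElectronString_apply_self (w x y z : ι) (D : Finset ι) :
    (creation w * creation x * annihilation y * annihilation z) D D =
      if y ∈ D ∧ z ∈ D then
        (if w = z ∧ x = y then 1 else 0) - (if w = y ∧ x = z then 1 else 0) else 0 := by
  rw [apply_eq_mulVec_single (creation w * creation x * annihilation y * annihilation z) D D,
    ← mulVec_mulVec, annihilation_mulVec_single]
  by_cases hz : z ∈ D
  swap
  · rw [if_neg hz, mulVec_zero, Pi.zero_apply, if_neg (fun h => hz h.2)]
  rw [if_pos hz, mulVec_smul, ← mulVec_mulVec, annihilation_mulVec_single]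
  by_cases hyz : y = z
  · -- `a_y a_y = 0`: both sides vanish
    subst hyz
    rw [if_neg (notMem_erase y D), mulVec_zero, smul_zero, Pi.zero_apply]
    split_ifs <;> simp_all
  by_cases hy : y ∈ D
  swap
  · rw [if_neg (fun h => hy (mem_of_mem_erase h)), mulVec_zero, smul_zero, Pi.zero_apply,
      if_neg (fun h => hy h.1)]
  have hyD : y ∈ D.erase z := mem_erase.2 ⟨hyz, hy⟩
  rw [if_pos hyD, if_pos ⟨hy, hz⟩, mulVec_smul, ← mulVec_mulVec,
    FermionOperatorsProofs.creation_mulVec_single]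
  set T := (D.erase z).erase y with hT
  -- useful identities
  have hT1 : insert y T = D.erase z := insert_erase hyD
  have hzy : z ∈ D.erase y := mem_erase.2 ⟨fun h => hyz h.symm, hz⟩
  have hT2 : T = (D.erase y).erase z := erase_right_comm
  have hT3 : insert z ((D.erase y).erase z) = D.erase y := insert_erase hzy
  have hyT : y ∉ T := notMem_erase y _
  have hzT : z ∉ T := by rw [hT2]; exact notMem_erase z _
  -- an element of `D` outside `T` is `y` or `z`
  have key : ∀ u, u ∈ D → u ∉ T → u = y ∨ u = z := by
    intro u huD huT
    by_cases huy : u = y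
    · exact Or.inl huy
    by_cases huz : u = z
    · exact Or.inr huz
    exact absurd (mem_erase.2 ⟨huy, mem_erase.2 ⟨huz, huD⟩⟩) huT
  by_cases hx : x ∈ T
  · -- `a†_x` kills: `x ∈ T ⊆ D ∖ {y,z}` so `x ≠ y`, `x ≠ z`
    rw [if_pos hx, mulVec_zero, smul_zero, smul_zero, Pi.zero_apply]
    have hxy : x ≠ y := fun h => hyT (h ▸ hx)
    have hxz : x ≠ z := fun h => hzT (h ▸ hx)
    rw [if_neg (fun h => hxy h.2), if_neg (fun h => hxz h.2), sub_zero]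
  rw [if_neg hx, mulVec_smul, FermionOperatorsProofs.creation_mulVec_single]
  by_cases hw : w ∈ insert x T
  · -- `a†_w` kills
    rw [if_pos hw, smul_zero, smul_zero, smul_zero, Pi.zero_apply]
    rcases mem_insert.1 hw with hwx | hwT
    · -- `w = x`: either Kronecker product would force `y = z`
      have h1 : ¬(w = z ∧ x = y) := fun h => hyz (h.2.symm.trans (hwx.symm.trans h.1))
      have h2 : ¬(w = y ∧ x = z) := fun h => hyz (h.1.symm.trans (hwx.trans h.2))
      rw [if_neg h1, if_neg h2, sub_zero]
    · have hwy : w ≠ y := fun h => hyT (h ▸ hwT)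
      have hwz : w ≠ z := fun h => hzT (h ▸ hwT)
      rw [if_neg (fun h => hwz h.1), if_neg (fun h => hwy h.1), sub_zero]
  rw [if_neg hw, smul_smul, smul_smul, smul_smul, Pi.smul_apply, smul_eq_mul]
  -- the resulting ON vector is `|T ∪ {x, w}⟩`; it equals `|D⟩` iff `{w, x} = {y, z}`
  by_cases hdir : w = z ∧ x = y
  · obtain ⟨rfl, rfl⟩ := hdir
    rw [if_pos ⟨rfl, rfl⟩, if_neg (fun h => hyz h.1.symm), sub_zero, hT1, insert_erase hz,
      Pi.single_eq_same, mul_one, jwSign_erase_of_not_lt (lt_irrefl x),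
      jwSign_erase_of_not_lt (lt_irrefl w)]
    -- `σ_w(D) σ_x(D∖w) σ_x(D∖w) σ_w(D) = 1`
    linear_combination (jwSign w D * jwSign w D) * jwSign_mul_self x (D.erase w) + jwSign_mul_self w D
  by_cases hexc : w = y ∧ x = z
  · obtain ⟨rfl, rfl⟩ := hexc
    rw [if_neg hdir, if_pos ⟨rfl, rfl⟩, zero_sub, hT2, hT3, insert_erase hy, Pi.single_eq_same,
      mul_one, jwSign_erase_of_not_lt (lt_irrefl x), jwSign_erase_of_not_lt (lt_irrefl w)]
    -- `σ_x(D) σ_w(D∖x) σ_x(D∖w) σ_w(D) = -1` by trichotomy on `w ≠ x`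
    have h4 : jwSign x D * jwSign w D * jwSign x D * jwSign w D = 1 := by
      linear_combination (jwSign w D * jwSign w D) * jwSign_mul_self x D + jwSign_mul_self w D
    rcases lt_or_gt_of_ne hyz with hwx | hxw
    · rw [jwSign_erase_of_not_lt (not_lt.2 hwx.le), jwSign_erase_of_lt hy hwx]
      linear_combination (-1 : ℂ) * h4
    · rw [jwSign_erase_of_lt hz hxw, jwSign_erase_of_not_lt (not_lt.2 hxw.le)]
      linear_combination (-1 : ℂ) * h4
  -- otherwise the string moves `|D⟩` to a different ON vector
  rw [if_neg hdir, if_neg hexc, sub_zero, Pi.single_eq_of_ne, mul_zero]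
  intro hD
  have hxD : x ∈ D := by rw [hD]; exact mem_insert_of_mem (mem_insert_self x _)
  have hwD : w ∈ D := by rw [hD]; exact mem_insert_self w _
  have hwx : w ≠ x := fun h => hw (by rw [h]; exact mem_insert_self x T)
  have hwT : w ∉ T := fun h => hw (mem_insert_of_mem h)
  rcases key x hxD hx with hx' | hx' <;> rcases key w hwD hwT with hw' | hw'
  · exact hwx (hw'.trans hx'.symm)
  · exact hdir ⟨hw', hx'⟩
  · exact hexc ⟨hw', hx'⟩
  · exact hwx (hw'.trans hx'.symm)

/-- The same diagonal element with the Kronecker deltas outermost (the shape used under sums):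
`⟨k| a†_w a†_x a_y a_z |k⟩ = δ_{wz}δ_{xy} k_y k_z − δ_{wy}δ_{xz} k_y k_z`.
[cite: HelgakerJorgensenOlsen2000, eqs. (1.4.28)–(1.4.31)] -/
theorem twoElectronString_apply_self' (w x y z : ι) (D : Finset ι) :
    (creation w * creation x * annihilation y * annihilation z) D D =
      (if w = z then (if x = y then (if y ∈ D ∧ z ∈ D then (1 : ℂ) else 0) else 0) else 0) -
        (if w = y then (if x = z then (if y ∈ D ∧ z ∈ D then (1 : ℂ) else 0) else 0) else 0) := by
  rw [twoElectronString_apply_self]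
  by_cases h : y ∈ D ∧ z ∈ D
  · simp only [if_pos h, ite_and]
  · simp only [if_neg h, ite_self, sub_zero]

/-! ### Entries of `f̂ = dΓ(f)` and `ĝ` as sums of string entries -/

/-- `⟨I| f̂ |J⟩ = Σ_{PQ} f_{PQ} ⟨I| a†_P a_Q |J⟩` — Helgaker–Jørgensen–Olsen (2000) eqs. (1.4.8),
(1.4.10). [cite: HelgakerJorgensenOlsen2000, eqs. (1.4.8), (1.4.10)] -/
theorem dGamma_apply (f : Matrix ι ι ℂ) (I J : Finset ι) :
    dGamma f I J = ∑ P, ∑ Q, f P Q * (creation P * annihilation Q) I J := by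
  simp only [dGamma_eq, Matrix.sum_apply, Matrix.smul_apply, smul_eq_mul]

/-- `⟨I| ĝ |J⟩ = ½ Σ_{PQRS} g_{PQRS} ⟨I| a†_P a†_R a_S a_Q |J⟩` — Helgaker–Jørgensen–Olsen (2000)
eqs. (1.4.26), (1.4.32). [cite: HelgakerJorgensenOlsen2000, eqs. (1.4.26), (1.4.32)] -/
theorem twoElectronOp_apply (g : ι → ι → ι → ι → ℂ) (I J : Finset ι) :
    twoElectronOp g I J = (1 / 2 : ℂ) * ∑ P, ∑ Q, ∑ R, ∑ S,
      g P Q R S * (creation P * creation R * annihilation S * annihilation Q) I J := by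
  simp only [twoElectronOp, Matrix.smul_apply, Matrix.sum_apply, smul_eq_mul]

/-! ### Case 1 — identical ON vectors: (1.4.3) and (1.4.18) -/

/-- **One-electron operator, identical ON vectors** — Helgaker–Jørgensen–Olsen (2000) eq. (1.4.3):
`⟨k| f̂ |k⟩ = Σ_P k_P f_{PP}`, i.e. the sum of the diagonal integrals over the occupied spin orbitals.
[cite: HelgakerJorgensenOlsen2000, eq. (1.4.3)] -/
theorem dGamma_apply_self (f : Matrix ι ι ℂ) (D : Finset ι) : dGamma f D D = ∑ P ∈ D, f P P := by
  simp only [dGamma_apply, creation_mul_annihilation_apply_self, ite_and, mul_ite, mul_one, mul_zero,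
    Finset.sum_ite_eq, Finset.mem_univ, if_true, Finset.sum_ite_mem, Finset.univ_inter]

/-- The collapse of the diagonal two-electron sum to the two index patterns of
Helgaker–Jørgensen–Olsen (2000) eq. (1.4.28) (as in (1.4.26) → (1.4.29)), here with the first
creation index `w` (occupied) held fixed:
`Σ_{QRS} G_{QRS} ⟨k| a†_w a†_R a_S a_Q |k⟩ = Σ_R k_R (G_{wRR} − G_{RRw})`.
[cite: HelgakerJorgensenOlsen2000, eqs. (1.4.28)–(1.4.29)] -/
theorem sum_mul_twoElectronString_apply_self (G : ι → ι → ι → ℂ) {w : ι} {D : Finset ι}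
    (hw : w ∈ D) :
    ∑ Q, ∑ R, ∑ S, G Q R S * (creation w * creation R * annihilation S * annihilation Q) D D =
      ∑ R ∈ D, (G w R R - G R R w) := by
  have h1 : ∀ Q R S, G Q R S * (creation w * creation R * annihilation S * annihilation Q) D D =
      (if w = Q then (if R = S then (if S ∈ D then G Q R S else 0) else 0) else 0) -
        (if w = S then (if R = Q then (if Q ∈ D then G Q R S else 0) else 0) else 0) := by
    intro Q R S
    rw [twoElectronString_apply_self', mul_sub]
    congr 1
    · by_cases hQ : w = Q
      · subst hQ
        by_cases hRS : R = S
        · subst hRS; simp [hw]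
        · simp [hRS]
      · simp [hQ]
    · by_cases hS : w = S
      · subst hS
        by_cases hRQ : R = Q
        · subst hRQ; simp [hw]
        · simp [hRQ]
      · simp [hS]
  simp only [h1, Finset.sum_sub_distrib, Finset.sum_ite_irrel, Finset.sum_const_zero,
    Finset.sum_ite_eq, Finset.sum_ite_eq', Finset.mem_univ, if_true, Finset.sum_ite_mem,
    Finset.univ_inter]

/-- **Two-electron operator, identical ON vectors** — Helgaker–Jørgensen–Olsen (2000) eq. (1.4.18):
`⟨k| ĝ |k⟩ = ½ Σ_{PR} k_P k_R (g_{PPRR} − g_{PRRP})` (Coulomb minus exchange over pairs of occupied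
spin orbitals). [cite: HelgakerJorgensenOlsen2000, eq. (1.4.18)] -/
theorem twoElectronOp_apply_self (g : ι → ι → ι → ι → ℂ) (D : Finset ι) :
    twoElectronOp g D D = (1 / 2 : ℂ) * ∑ P ∈ D, ∑ R ∈ D, (g P P R R - g P R R P) := by
  rw [twoElectronOp_apply]
  congr 1
  have h1 : ∀ P, ∑ Q, ∑ R, ∑ S,
      g P Q R S * (creation P * creation R * annihilation S * annihilation Q) D D =
      if P ∈ D then ∑ R ∈ D, (g P P R R - g P R R P) else 0 := by
    intro P
    by_cases hP : P ∈ D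
    · rw [if_pos hP, sum_mul_twoElectronString_apply_self (fun Q R S => g P Q R S) hP]
    · rw [if_neg hP]
      refine Finset.sum_eq_zero fun Q _ => Finset.sum_eq_zero fun R _ =>
        Finset.sum_eq_zero fun S _ => ?_
      -- `a†_P … |D⟩` has no component along `|D⟩` when `P ∉ D`: use the diagonal rule
      rw [twoElectronString_apply_self]
      by_cases hSQ : S ∈ D ∧ Q ∈ D
      · have hPQ : ¬(P = Q ∧ R = S) := fun h => hP (h.1 ▸ hSQ.2)
        have hPS : ¬(P = S ∧ R = Q) := fun h => hP (h.1 ▸ hSQ.1)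
        rw [if_pos hSQ, if_neg hPQ, if_neg hPS, sub_zero, mul_zero]
      · rw [if_neg hSQ, mul_zero]
  simp only [h1]
  rw [← Finset.sum_filter, Finset.filter_mem_eq_inter, Finset.univ_inter]

end SpinOrbital

end Literature.MathematicalPhysics.QuantumChemistry
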